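import Summits.NavierStokesRegularity.NavierStokesRegularity.Theorems.FrozenSignCascadeBoundedEnvelopeContinuationBackwardBoundedOfMorrey
import Literature.Analysis.FluidPDE.AxisymmetricL3BallMeanGauge
import Literature.Analysis.FluidPDE.LocalTypeIReverseTools
import Literature.Analysis.FluidPDE.SereginSverakBlowupSelection
import Literature.Analysis.FluidPDE.SereginSverakPressureDecayBalls
import Literature.Analysis.FluidPDE.ClassicalSolutionRescale
import HarnessLib

/-!
# Route FrozenSignCascade · crux `BoundedEnvelopeContinuation` — stub AX2: the zoom bundle at an
# axis point

Helper file (theorems only) for the crux item stmt-NavierStokesRegularity-10579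
(`BoundedEnvelopeContinuation`, conjunct (B) of route `FrozenSignCascade`); lands `--supports` that
item and proves the registered stub `zoomBundle_axis` (AX2 of the lead's support theorem "crux (B)
holds unconditionally for AXISYMMETRIC data"): the parabolic zoom about a final-time axis point
`(T, x₀)` of a classical Leray–Hopf solution with a critical Morrey bound, packaged exactly as the
input of Seregin–Šverák 2009, Thm. 3.2 (`SereginSverak2009.isRegularAtOrigin_of_axisDecay_holds`):
a classical unit-viscosity pair `(w, ϖ)` on the window `(-25, 0)` with axisymmetric slices, finite
Albritton–Barker Type I quantity on `Q((0,0), 5)`, a local axisymmetric solution on the unit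
Seregin–Šverák cylinder, bounded away from the top time, and such that regularity of the origin
for `w` is backward boundedness of `u` at `(T, x₀)`.

Construction. Step 1 is c1's `exists_zoom_typeIBound_lt_top_of_morrey` (this directory,
`…BackwardBoundedOfMorrey.lean`): the viscosity-normalising zoom `v = α₁ u ∘ Φ₁`
(`α₁ = R₁/ν`, `β₁ = R₁²/ν`) has finite Type I quantity on `Q((0,0), 1/2)` for Tao's gauge of the
pressure. Step 2 is the Navier–Stokes zoom by the factor `c = 1/10` (`typeIBound_nsZoom`), which
maps `Q((0,0), 1/2)` onto `Q((0,0), 5)`; the scales of the stub are `α = c α₁`, `β = c² β₁`,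
`R = c R₁`. The ONE pressure `ϖ` asked for must be simultaneously jointly smooth (classical pair)
and `L^{3/2}` on a cylinder touching the top time, which neither the callback's `p` (arbitrary up
to a smooth function of time) nor Tao's gauge (only measurable in time) is known to be; we take
the zoom of the **ball-mean gauge** `p − k`, `k(t) = ⨍_{B(0,1)} p(t)` of
`Literature/Analysis/FluidPDE/AxisymmetricL3BallMeanGauge.lean`: it is classical
(`IsClassicalNSSolutionOn.sub_timeFun`, `IsSmoothSpaceTimeOn.contDiffOn_setAverage_ball`,
`IsClassicalNSSolutionOn.stRescale`), it differs from the zoom of Tao's gauge by a function of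
time only, to which the Type I quantity is blind (`cknDOsc_sub_fun_time`), and it is `L^{3/2}` up
to the final time (`AxisymmetricL3Hyp.lintegral_prod_pressure_sub_ballMean_lt_top`), a bound
transported along the zoom by `setLIntegral_enorm_rpow_stRescale`.

## References

* G. Seregin, V. Šverák, Comm. Partial Differential Equations 34 (2009) 171–201 =
  arXiv:0804.1803, §2 (the zoom at a potential singular point) and Thm. 3.2 (its hypotheses).
  [SereginSverak2009]
* D. Albritton, T. Barker, J. Math. Fluid Mech. 21 (2019) = arXiv:1811.00502, §1 (the Type I
  quantity `𝐈(ω)`), Lemma 2.6. [AlbrittonBarker2019]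
* T. Tao, Anal. PDE 6 (2013) = arXiv:1108.1165, Lemma 4.1 (i). [Tao2011]
-/

noncomputable section

set_option linter.dupNamespace false -- nested layout Summit.<S>.<Sub>, Sub = S (D-0017)

open Set Filter Topology MeasureTheory
open scoped ContDiff

namespace Summit.NavierStokesRegularity.NavierStokesRegularity.Theorems.BoundedEnvelope

open Literature.Analysis Literature.Analysis.FluidPDE Literature.Analysis.FluidPDE.SereginSverak2002
  Function TopologicalSpace Metric
open scoped ENNReal NNReal

/-- **Stub AX2 of the registered line of the crux `BoundedEnvelopeContinuation`: the zoom bundle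
at an axis point.** For a classical solution `(u, p)` on `[0, T)` (viscosity `ν > 0`), Leray–Hopf
on `[0, T)` from `u 0`, bounded on sub-slabs, with axisymmetric slices obeying the critical Morrey
bound `∫_{B_r(x₁)} |u(t)|² ≤ M r`, and an axis point `x₀` (`x₀₀ = x₀₁ = 0`), there are scales
`α, β, R > 0` and a pressure `ϖ` such that the zoom `w(s, y) = α u(T + β s, x₀ + R y)` forms a
classical unit-viscosity solution `(w, ϖ)` on the window `(-25, 0)` with axisymmetric slices,
finite Albritton–Barker Type I quantity on `Q((0,0), 5)` (gradient `∇w`), a local axisymmetric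
solution on the unit Seregin–Šverák cylinder (`w ∈ L³`, `ϖ ∈ L^{3/2}`, distributional system),
bounded away from the top time, and such that regularity of the origin for `w` gives backward
boundedness of `u` at `(T, x₀)` (`SereginSverak2002.isBackwardBoundedAt_of_zoom`). The pressure is
the zoom of the ball-mean gauge `p − ⨍_{B(0,1)} p(t)` (module docstring).
[cite: SereginSverak2009, §2 and Thm. 3.2 (hypotheses)] -/
theorem zoomBundle_axis :
    ∀ ν T : ℝ, 0 < ν → 0 < T →
      ∀ (u : ℝ → EuclideanSpace ℝ (Fin 3) → EuclideanSpace ℝ (Fin 3))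
        (p : ℝ → EuclideanSpace ℝ (Fin 3) → ℝ),
        Literature.Analysis.FluidPDE.IsClassicalNSSolutionOn (Set.Ico 0 T) ν 0 u p →
        Literature.Analysis.FluidPDE.IsLerayHopfOn T ν 0 (u 0) u →
        (∀ t < T, ∃ B : ℝ, ∀ s ∈ Set.Icc 0 t, ∀ x, ‖u s x‖ ≤ B) →
        (∀ t ∈ Set.Ico 0 T, Literature.Analysis.FluidPDE.IsAxisymmetric (u t)) →
        (∃ M : ℝ, ∀ t ∈ Set.Ioo 0 T, ∀ (x₁ : EuclideanSpace ℝ (Fin 3)) (r : ℝ), 0 < r →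
          ∫ x in Metric.ball x₁ r, ‖u t x‖ ^ 2 ≤ M * r) →
        ∀ x₀ : EuclideanSpace ℝ (Fin 3), x₀ 0 = 0 → x₀ 1 = 0 →
        ∃ (α β R : ℝ) (w : ℝ → EuclideanSpace ℝ (Fin 3) → EuclideanSpace ℝ (Fin 3))
          (ϖ : ℝ → EuclideanSpace ℝ (Fin 3) → ℝ),
          0 < α ∧ 0 < β ∧ 0 < R ∧
          (∀ s y, w s y = α • u (T + β * s) (x₀ + R • y)) ∧
          Literature.Analysis.FluidPDE.IsClassicalNSSolutionOn (Set.Ioo (-25) 0) 1 0 w ϖ ∧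
          (∀ s ∈ Set.Ioo (-25 : ℝ) 0, Literature.Analysis.FluidPDE.IsAxisymmetric (w s)) ∧
          Literature.Analysis.FluidPDE.typeIBound
            (Literature.Analysis.FluidPDE.parabolicCylinder 5
              ((0 : ℝ), (0 : EuclideanSpace ℝ (Fin 3))))
            w ϖ (fun s y => fderiv ℝ (w s) y) < ⊤ ∧
          Literature.Analysis.FluidPDE.SereginSverak2009.IsAxisymmetricLocalSolution w ϖ ∧
          Literature.Analysis.FluidPDE.SereginSverak2009.IsBoundedAwayFromZero w ∧
          (Literature.Analysis.FluidPDE.SereginSverak2009.IsRegularAtOrigin w →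
            Literature.Analysis.FluidPDE.IsBackwardBoundedAt u T x₀) := by
  intro ν T hν hT u p hsol hLH hbdd haxi hMor x₀ hx0 hx1
  have H : AxisymmetricL3Hyp ν T u p := ⟨hν, hT, hsol, hLH, hbdd, haxi⟩
  -- Step 1: the viscosity-normalising zoom of c1 (Morrey hypothesis in a.e. form)
  have hMor' : ∃ M₀ : ℝ, ∀ᵐ t ∂(volume.restrict (Ioo 0 T)),
      ∀ (x₁ : EuclideanSpace ℝ (Fin 3)) (r : ℝ), 0 < r → 17 * r ≤ 1 →
        ∫ x in ball x₁ r, ‖u t x‖ ^ 2 ≤ M₀ * r := by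
    obtain ⟨M, hM⟩ := hMor
    exact ⟨M, (ae_restrict_mem measurableSet_Ioo).mono fun t ht x₁ r hr _ => hM t ht x₁ r hr⟩
  obtain ⟨R, α, β, hR, hα, hβ, hβdef, hαdef, hβT, -, -, htypeI⟩ :=
    exists_zoom_typeIBound_lt_top_of_morrey hν hT hsol hLH hMor' x₀
  -- Step 2: the further Navier–Stokes zoom by the factor `c = 1/10`
  set c : ℝ := 1 / 10 with hc
  have hcpos : 0 < c := by rw [hc]; norm_num
  have hc2 : c ^ 2 = 1 / 100 := by rw [hc]; norm_num
  have hα' : 0 < c * α := mul_pos hcpos hα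
  have hβ' : 0 < c ^ 2 * β := by positivity
  have hR' : 0 < c * R := mul_pos hcpos hR
  have hβ'T : 100 * (c ^ 2 * β) ≤ T := by rw [hc2]; linarith
  have hβ'T' : c ^ 2 * β ≤ T := by linarith
  have hβ'def : c ^ 2 * β = (c * R) ^ 2 / ν := by rw [hβdef]; ring
  have hwin : ∀ s ∈ Ioo (-25 : ℝ) 0, T + c ^ 2 * β * s ∈ Ioo 0 T := fun s hs =>
    ⟨by linarith [mul_lt_mul_of_pos_left hs.1 hβ'], by linarith [mul_lt_mul_of_pos_left hs.2 hβ']⟩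
  -- the smooth ball-mean gauge `k` and the fields
  set k : ℝ → ℝ := fun t => ⨍ y in ball (0 : EuclideanSpace ℝ (Fin 3)) 1, p t y with hk
  set q : ℝ → EuclideanSpace ℝ (Fin 3) → ℝ := fun t x => p t x - k t with hq
  set q₀ : ℝ → EuclideanSpace ℝ (Fin 3) → ℝ :=
    fun t x => p t x - (p t 0 - normalisedPressure (u t) 0) with hq₀
  set w : ℝ → EuclideanSpace ℝ (Fin 3) → EuclideanSpace ℝ (Fin 3) :=
    (c * α) • stPull (c ^ 2 * β) (c * R) T x₀ u with hw
  set ϖ : ℝ → EuclideanSpace ℝ (Fin 3) → ℝ :=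
    (c * α) ^ 2 • stPull (c ^ 2 * β) (c * R) T x₀ q with hϖ
  set πt : ℝ → EuclideanSpace ℝ (Fin 3) → ℝ :=
    (c * α) ^ 2 • stPull (c ^ 2 * β) (c * R) T x₀ q₀ with hπt
  set Gt : ℝ → EuclideanSpace ℝ (Fin 3) → EuclideanSpace ℝ (Fin 3) →L[ℝ] EuclideanSpace ℝ (Fin 3) :=
    (c ^ 2 * (α * R)) • stPull (c ^ 2 * β) (c * R) T x₀ (fun t x => fderiv ℝ (u t) x) with hGt
  -- (a) the pair `(w, ϖ)` is classical on the window `(-25, 0)`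
  have hqcl : IsClassicalNSSolutionOn (Ioo 0 T) ν 0 u q :=
    H.classical_Ioo.sub_timeFun
      (H.classical_Ioo.smooth_pressure.contDiffOn_setAverage_ball isOpen_Ioo 0 1)
  have hclass : IsClassicalNSSolutionOn (Ioo (-25 : ℝ) 0) 1 0 w ϖ := by
    have hβrel : c ^ 2 * β = (c * α) * (c * R) := by rw [hβdef, hαdef]; field_simp
    have key := hqcl.stRescale hα' hR' hβrel T x₀
    have hvisc : c * α * ν / (c * R) = 1 := by rw [hαdef]; field_simp
    have hforce : (((c * α) ^ 2 * (c * R)) • stPull (c ^ 2 * β) (c * R) T x₀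
        (0 : ℝ → EuclideanSpace ℝ (Fin 3) → EuclideanSpace ℝ (Fin 3))) = 0 := by
      funext s y; simp [stPull]
    rw [hvisc, hforce] at key
    exact key.mono (fun s hs => hwin s hs) isOpen_Ioo.uniqueDiffOn
  -- (b) axisymmetric slices (`x₀ = x₀₃ e₃` lies on the axis)
  have hx : x₀ = (x₀ 2) • (eZ : EuclideanSpace ℝ (Fin 3)) := by
    ext i
    fin_cases i <;> simp [eZ, hx0, hx1]
  have haxiw : ∀ s ∈ Ioo (-25 : ℝ) 0, IsAxisymmetric (w s) := by
    intro s hs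
    have e : w s = fun y => (c * α) • u (T + c ^ 2 * β * s)
        ((x₀ 2) • (eZ : EuclideanSpace ℝ (Fin 3)) + (c * R) • y) := by
      funext y
      show (c * α) • u (T + c ^ 2 * β * s) (x₀ + (c * R) • y) = _
      rw [← hx]
    rw [e]
    exact SereginSverak2009.isAxisymmetric_rescale (haxi _ (Ioo_subset_Ico_self (hwin s hs)))
      (c * α) (x₀ 2) (c * R)
  -- (c) the Type I quantity: `(w, πt, Gt)` is the NS zoom of c1's triple
  have e1 : ∀ s : ℝ, T + β * (c ^ 2 * s) = T + c ^ 2 * β * s := fun s => by ring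
  have e2 : ∀ y : EuclideanSpace ℝ (Fin 3), (R * c) • y = (c * R) • y := fun y => by
    rw [mul_comm]
  have e3 : c ^ 2 * α ^ 2 = (c * α) ^ 2 := by ring
  have I1 : c • stPull (c ^ 2) c 0 0 (α • stPull β R T x₀ u) = w := by
    funext s y
    simp only [hw, Pi.smul_apply, stPull_apply, smul_smul, zero_add, e1, e2]
  have I2 : c ^ 2 • stPull (c ^ 2) c 0 0 (α ^ 2 • stPull β R T x₀ q₀) = πt := by
    funext s y
    simp only [hπt, Pi.smul_apply, stPull_apply, smul_smul, zero_add, e1, e2, e3]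
  have I3 : c ^ 2 • stPull (c ^ 2) c 0 0 ((α * R) • stPull β R T x₀ fun t x => fderiv ℝ (u t) x) =
      Gt := by
    funext s y
    simp only [hGt, Pi.smul_apply, stPull_apply, smul_smul, zero_add, e1, e2]
  have htypeI' :
      typeIBound (parabolicCylinder 5 (0 : ℝ × EuclideanSpace ℝ (Fin 3))) w πt Gt < ⊤ := by
    have h := typeIBound_nsZoom hcpos 0 (0 : EuclideanSpace ℝ (Fin 3))
      (parabolicCylinder (1 / 2) (0 : ℝ × EuclideanSpace ℝ (Fin 3)))
      (α • stPull β R T x₀ u) (α ^ 2 • stPull β R T x₀ q₀)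
      ((α * R) • stPull β R T x₀ fun t x => fderiv ℝ (u t) x)
    rw [I1, I2, I3, stAffine_preimage_parabolicCylinder_zero hcpos,
      show (1 / 2 : ℝ) / c = 5 by rw [hc]; norm_num] at h
    rw [h]
    exact htypeI
  -- `ϖ` and `πt` differ by a function of time only, to which `D` is blind
  set g : ℝ → ℝ := fun s => (c * α) ^ 2 * (k (T + c ^ 2 * β * s) -
      (p (T + c ^ 2 * β * s) 0 - normalisedPressure (u (T + c ^ 2 * β * s)) 0)) with hg
  have hϖπ : ϖ = fun s y => πt s y - g s := by
    funext s y
    simp only [hϖ, hπt, hg, hq, hq₀, smul_stPull_apply, smul_eq_mul]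
    ring
  have hslice_int : ∀ s ∈ Ioo (-25 : ℝ) 0, ∀ (x : EuclideanSpace ℝ (Fin 3)) (ρ : ℝ),
      IntegrableOn (πt s) (ball x ρ) volume := by
    intro s hs x ρ
    have ht := hwin s hs
    have hpc : Continuous (p (T + c ^ 2 * β * s)) :=
      (hsol.contDiff_pressure (Ioo_subset_Ico_self ht)).continuous
    have hcont : Continuous (πt s) := by
      have e : πt s = fun y => (c * α) ^ 2 * (p (T + c ^ 2 * β * s) (x₀ + (c * R) • y) -
          (p (T + c ^ 2 * β * s) 0 - normalisedPressure (u (T + c ^ 2 * β * s)) 0)) := by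
        funext y
        simp only [hπt, smul_stPull_apply, hq₀, smul_eq_mul]
      rw [e]
      have h1 : Continuous fun y : EuclideanSpace ℝ (Fin 3) => x₀ + (c * R) • y := by fun_prop
      exact continuous_const.mul ((hpc.comp h1).sub continuous_const)
    exact (hcont.continuousOn.integrableOn_compact (isCompact_closedBall x ρ)).mono_set
      ball_subset_closedBall
  have htypeIϖ : typeIBound (parabolicCylinder 5 (0 : ℝ × EuclideanSpace ℝ (Fin 3))) w ϖ Gt ≤
      typeIBound (parabolicCylinder 5 (0 : ℝ × EuclideanSpace ℝ (Fin 3))) w πt Gt := by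
    refine typeIBound_le_iff.2 fun r hr z hz => ?_
    have hD : cknDOsc r z ϖ = cknDOsc r z πt := by
      rw [hϖπ]
      refine cknDOsc_sub_fun_time hr g ?_
      refine (ae_restrict_mem measurableSet_Ioo).mono fun s hs => ?_
      have hmem : ((s, z.2) : ℝ × EuclideanSpace ℝ (Fin 3)) ∈ parabolicCylinder r z := by
        rw [mem_parabolicCylinder]; exact ⟨hs, by simp [hr]⟩
      have h5 := hz hmem
      rw [mem_parabolicCylinder] at h5
      norm_num at h5
      exact hslice_int s ⟨by linarith [h5.1.1], h5.1.2⟩ z.2 r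
    calc abScaledSum r z w ϖ Gt = abScaledSum r z w πt Gt := by simp only [abScaledSum, hD]
      _ ≤ _ := abScaledSum_le_typeIBound hr hz
  have hGw : (fun s y => fderiv ℝ (w s) y) = Gt := by
    funext s y
    have e1 : w s = (c * α) • stPull (c ^ 2 * β) (c * R) T x₀ u s := rfl
    rw [e1, fderiv_const_smul_field, Pi.smul_apply, fderiv_stPull, smul_smul]
    simp only [hGt, Pi.smul_apply, stPull_apply]
    congr 1
    ring
  -- (d) the local axisymmetric solution on the unit Seregin–Šverák cylinder
  have hsub1 : SereginSverak2009.parCyl 0 1 ⊆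
      parabolicCylinder (3 / 2) (0 : ℝ × EuclideanSpace ℝ (Fin 3)) := by
    refine (Literature.Analysis.FluidPDE.parCyl_subset_parabolicCylinder 0 zero_le_one).trans ?_
    rw [mul_one]
    exact SuitableCompactness.parabolicCylinder_zero_mono (Real.sqrt_nonneg _)
      (Real.sqrt_le_iff.2 ⟨by norm_num, by norm_num⟩)
  have hlocal : SereginSverak2009.IsAxisymmetricLocalSolution w ϖ := by
    refine ⟨?_, ?_, ?_, fun s hs => haxiw s ⟨by linarith [hs.1], hs.2⟩⟩
    · -- Navier–Stokes in the sense of distributions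
      have hQ : ((SereginSverak2009.parCylOpens 0 1 : Opens (ℝ × EuclideanSpace ℝ (Fin 3))) :
          Set (ℝ × EuclideanSpace ℝ (Fin 3))) ⊆ Ioo (-25 : ℝ) 0 ×ˢ univ := by
        rintro ⟨s, y⟩ hz
        rw [SereginSverak2009.coe_parCylOpens, SereginSverak2009.mem_parCyl_zero] at hz
        have h1 := hz.1
        norm_num at h1
        exact ⟨⟨by linarith [h1.1], h1.2⟩, mem_univ _⟩
      refine isDistributionalNSSolutionOn_of_contDiffOn isOpen_Ioo hQ
        (hclass.smooth_velocity.of_le (by norm_cast))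
        (hclass.smooth_pressure.of_le (by norm_cast)) continuousOn_const (fun s hs y => ?_)
        hclass.divFree
      have e : timeDerivWithin (Ioo (-25 : ℝ) 0) w s y = timeDeriv w s y := by
        simp only [timeDerivWithin, timeDeriv]
        exact derivWithin_of_isOpen isOpen_Ioo hs
      rw [← e]
      exact hclass.momentum s hs y
    · -- `w ∈ L³(Q)`, from the `C`-part of the finite Type I quantity on `Q((0,0), 3/2)`
      have hC : cknC (3 / 2) (0 : ℝ × EuclideanSpace ℝ (Fin 3)) w < ⊤ :=
        lt_of_le_of_lt ((cknC_le_abScaledSum (p := πt) (G := Gt)).trans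
          (abScaledSum_le_typeIBound (by norm_num)
            (SuitableCompactness.parabolicCylinder_zero_mono (by norm_num) (by norm_num))))
          htypeI'
      unfold cknC at hC
      have hne : (ENNReal.ofReal (3 / 2 : ℝ) ^ 2)⁻¹ ≠ 0 :=
        ENNReal.inv_ne_zero.2 (ENNReal.pow_ne_top ENNReal.ofReal_ne_top)
      have hint : ∫⁻ q in parabolicCylinder (3 / 2) (0 : ℝ × EuclideanSpace ℝ (Fin 3)),
          ‖w q.1 q.2‖ₑ ^ (3 : ℕ) < ⊤ := by
        by_contra h
        rw [not_lt, top_le_iff] at h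
        rw [h, ENNReal.mul_top hne] at hC
        exact lt_irrefl _ hC
      exact lt_of_le_of_lt (lintegral_mono_set hsub1) hint
    · -- `ϖ ∈ L^{3/2}(Q)`: the ball-mean gauge transported along the zoom
      have hρ : ((3 / 2) * (c * R)) ^ 2 / ν = (9 / 4) * (c ^ 2 * β) := by rw [hβdef]; ring
      have ha : 0 ≤ T - ((3 / 2) * (c * R)) ^ 2 / ν := by rw [hρ]; linarith
      have h := stAffine_preimage_cylinder_eq_parabolicCylinder hν hR' T x₀ ((3 / 2) * (c * R))
      rw [mul_div_cancel_right₀ _ hR'.ne', ← hβ'def] at h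
      have e : parabolicCylinder (3 / 2) (0 : ℝ × EuclideanSpace ℝ (Fin 3)) =
          parabolicCylinder (3 / 2) ((0 : ℝ), (0 : EuclideanSpace ℝ (Fin 3))) := rfl
      refine lt_of_le_of_lt (lintegral_mono_set hsub1) ?_
      rw [e, ← h, hϖ, setLIntegral_enorm_rpow_stRescale hβ' hR' T x₀ ((c * α) ^ 2) q _
        (by norm_num)]
      refine ENNReal.mul_lt_top (ENNReal.mul_lt_top
        (ENNReal.rpow_lt_top_of_nonneg (by norm_num) enorm_ne_top) ENNReal.ofReal_lt_top) ?_
      exact H.lintegral_prod_pressure_sub_ballMean_lt_top ha x₀ _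
  -- (e) bounded away from the top time, from the bounds of `u` on sub-slabs
  have hbaz : SereginSverak2009.IsBoundedAwayFromZero w := by
    intro a ha
    have ha2 : 0 < a ^ 2 := by have := ha.1; positivity
    have haT : T - c ^ 2 * β * a ^ 2 < T := by linarith [mul_pos hβ' ha2]
    obtain ⟨B, hB⟩ := hbdd (T - c ^ 2 * β * a ^ 2) haT
    refine ⟨c * α * B,
      (ae_restrict_mem (SereginSverak2009.isOpen_parCyl 0 1).measurableSet).mono
        fun z hz hza => ?_⟩
    rw [SereginSverak2009.mem_parCyl_zero] at hz
    have hz1 := hz.1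
    norm_num at hz1
    have ht : T + c ^ 2 * β * z.1 ∈ Icc 0 (T - c ^ 2 * β * a ^ 2) := by
      constructor
      · linarith [mul_lt_mul_of_pos_left hz1.1 hβ']
      · linarith [mul_lt_mul_of_pos_left hza hβ']
    have hb := hB _ ht (x₀ + (c * R) • z.2)
    show ‖(c * α) • u (T + c ^ 2 * β * z.1) (x₀ + (c * R) • z.2)‖ ≤ c * α * B
    rw [norm_smul, Real.norm_of_nonneg hα'.le]
    exact mul_le_mul_of_nonneg_left hb hα'.le
  -- (f) regularity of the origin for `w` is backward boundedness of `u` at `(T, x₀)`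
  have hreg : SereginSverak2009.IsRegularAtOrigin w → IsBackwardBoundedAt u T x₀ := by
    rintro ⟨r, hr, hfin⟩
    have hfin' : eLpNorm (uncurry w) ⊤ (volume.restrict
        (parabolicCylinder (min r 1) (0 : ℝ × EuclideanSpace ℝ (Fin 3)))) < ⊤ := by
      refine lt_of_le_of_lt (eLpNorm_mono_measure _ (Measure.restrict_mono ?_ le_rfl)) hfin
      exact (Literature.Analysis.FluidPDE.parabolicCylinder_subset_parCyl 0 (min r 1)).trans
        (SereginSverak2009.parCyl_mono 0 (le_min hr.le zero_le_one) (min_le_left _ _))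
    exact isBackwardBoundedAt_of_zoom hsol x₀ hR' hα' hβ' hβ'T' (lt_min hr one_pos)
      (min_le_right _ _) hfin'
  refine ⟨c * α, c ^ 2 * β, c * R, w, ϖ, hα', hβ', hR', fun s y => rfl, hclass, haxiw, ?_,
    hlocal, hbaz, hreg⟩
  rw [hGw]
  exact lt_of_le_of_lt htypeIϖ htypeI'

end Summit.NavierStokesRegularity.NavierStokesRegularity.Theorems.BoundedEnvelope

end
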